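import Literature.NumberTheory.GaloisRepresentations.ArtinKernelForm
import Literature.NumberTheory.GaloisRepresentations.UnitIdeles
import Literature.NumberTheory.Automorphic.ClassFieldCharacter
import Literature.NumberTheory.Automorphic.IdeleIdealClass
import HarnessLib

/-!
# From the idelic to the ideal-theoretic norm index:
# `[J_K : Kˣ N_{L/K} J_L]` divides `[ℐ_K(𝔪) : 𝒫⁺_{K,𝔪} 𝒩_{L/K}(𝔪)]`

Topic `NumberTheory/GaloisRepresentations` (class field theory: the passage between Childress,
*Class Field Theory*, Ch. 4 §5 Thm. 5.12 in its idelic form `[J_F : Fˣ N_{K/F} J_K] ≥ [K : F]`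
— the tree's `IdeleHerbrand.card_dvd_index_normGroup` — and its printed, ideal-theoretic form
`[ℐ_F(𝔪) : 𝒫⁺_{F,𝔪} 𝒩_{K/F}(𝔪)] ≥ [K : F]`, which is the hypothesis of the tree's assembly of Artin's
reciprocity law, `artinReciprocity_rankOne_of_globalCyclicNormIndex`); namespace
`Literature.NumberTheory.GaloisRepresentations`.  Everything here is **proved**; the two local
inputs enter as explicit hypotheses, spelled out inline (no named fact):

* `hW` — **the modulus `𝔪` is admissible**: `W_𝔪 ∩ 𝕌_K ≤ Kˣ N_{L/K} J_L`, i.e. an idele which is a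
  local unit at every finite place, `≡ 1 mod 𝔭^{n_𝔭}` at the primes `𝔭^{n_𝔭} ∥ 𝔪` and positive at
  the real places lies in the norm group (Childress Ch. 4 §2, "`𝓔⁺_{F,𝔪} ⊆ F^× N_{K/F} J_K` for `𝔪`
  divisible by sufficiently high powers of the ramified primes"; locally: unramified units are
  norms, `U^{(n)}` is a norm for `n ≫ 0`, positive reals are norms from `ℂ`);
* `hFrob` — **`𝔮^{f_𝔮}` is a norm**: for `𝔮 ∤ 𝔪` and `𝔔 ∣ 𝔮` in `L`, the local idele
  `⟨ϖ_𝔮⟩^{f(𝔔|𝔮)}` lies in the norm group (for `𝔮` unramified, `ϖ_𝔮^{f} = N_{L_𝔔/K_𝔮}(ϖ_𝔮)`).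

## Main results

* `idealIdele : (FractionalIdeal (𝓞 K)⁰ K)ˣ →* 𝕀_K`, `𝔞 = ∏ 𝔭^{ν_𝔭} ↦ ∏ ⟨ϖ_𝔭⟩^{ν_𝔭}` (the Artin
  homomorphism of the datum `𝔭 ↦ ⟨ϖ_𝔭⟩`, `ϖ_𝔭 = uniformizer K 𝔭` the image of a global
  uniformizer), with `ord_𝔭 (idealIdele 𝔞) = ν_𝔭(𝔞)`; and `ideleIdeal : 𝕀_K → (FractionalIdeal)ˣ`,
  `x ↦ (x) = ∏ 𝔭^{ord_𝔭 x}` (Cassels–Fröhlich II §17), with `ν_𝔭((x)) = ord_𝔭 x`.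
* `mk_idealIdele_ideleIdeal_eq` — for `y ∈ W_𝔪`, `y ≡ idealIdele (y) (mod W_𝔪 ∩ 𝕌_K)`; hence,
  under `hW`, **`ℐ_K(𝔪) → J_K / Kˣ N J_L` is onto** (`exists_mem_idealsPrimeTo_mk_idealIdele_eq`,
  weak approximation `𝕀_K = Kˣ W_𝔪`, `exists_principalIdele_mul_mem_congruenceIdeles`);
* `ray_le_ker_idealIdeleQuot` — under `hW` the ray `𝒫⁺_{K,𝔪}` dies in `J_K / Kˣ N J_L` (a ray
  element `a` gives the principal idele `(a) ∈ W_𝔪`);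
* `normSubgroup_le_ker_idealIdeleQuot` — under `hFrob` so does `𝒩_{L/K}(𝔪)`;
* `index_normGroup_dvd_relIndex_ray_sup_normSubgroup` — **the dictionary**:
  `[J_K : Kˣ N_{L/K} J_L] ∣ [ℐ_K(𝔪) : 𝒫⁺_{K,𝔪} 𝒩_{L/K}(𝔪)]`, and
  `finrank_le_relIndex_ray_sup_normSubgroup_of_dvd_index` — with the idelic first inequality
  `[L : K] ∣ [J_K : Kˣ N J_L] ≠ 0` as a further input, the **Global Cyclic Norm Index Inequality in
  ideal-theoretic form** `[L : K] ≤ [ℐ_K(𝔪) : 𝒫⁺_{K,𝔪} 𝒩_{L/K}(𝔪)]` (Childress Thm. 5.12 as printed).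

## References

* N. Childress, *Class Field Theory*, Universitext, Springer 2009, Ch. 4 §2 (ideles and ray
  classes, `J_F / F^× 𝓔⁺_{F,𝔪} ≅ ℐ_F(𝔪)/𝒫⁺_{F,𝔪}`), §5 Thm. 5.12 (PDF pp. 75–80, 103).
  [Childress2009]
* J. Neukirch, *Algebraic Number Theory*, Grundlehren 322, Springer 1999, Ch. VI §1 Prop. (1.9)
  (`C_K/C_K^𝔪 ≅ Cl_K^𝔪`), §7 proof of (7.1). [NeukirchANT1999]
* J. W. S. Cassels, A. Fröhlich (eds.), *Algebraic Number Theory* (1967), Ch. II §17 (ideals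
  and ideles), Ch. VII §4 Prop. 4.1. [CasselsFrohlichANT1967]

## Mathlib / tree search

`lean search 'congruenceIdeles|ideleOrd|normGroup|toFractionalIdeal'`: the tree has the congruence
subgroup `W_𝔣` with `𝕀_K = Kˣ W_𝔣` (`HeckeCharacterOfRayClass.lean`, for the character form of
Neukirch VI (1.9)), the norm group `normGroup K L = Kˣ N(𝔸_Lˣ)` (`Automorphic/ClassFieldCharacter`),
the ideal of a finite idele (`Automorphic/IdeleIdealClass`), the unit ideles (`UnitIdeles.lean`)
and the ideal-theoretic side `idealsPrimeTo`/`ray`/`normSubgroup`/`artinHom` (`RayClassGroup.lean`,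
`ArtinNormSubgroup.lean`); no comparison of the two norm indices before this file (the quadratic
case `QuadraticForms/QuadraticRayClassNormIndex.lean` argues by `index ≠ 1`).
-/

noncomputable section

open NumberField IsDedekindDomain IsDedekindDomain.HeightOneSpectrum

open scoped nonZeroDivisors

namespace Literature.NumberTheory.GaloisRepresentations

open Literature.NumberTheory.Automorphic

universe u v

variable {K : Type u} [Field K] [NumberField K]

/-! ### Orders of products and powers of ideles -/

/-- `ord_w` of a finite product of ideles is the sum of the orders. [folklore] -/
theorem ideleOrd_prod {ι : Type*} (s : Finset ι) (f : ι → ideleGroup K) (w : HeightOneSpectrum (𝓞 K)) :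
    ideleOrd (∏ i ∈ s, f i) w = ∑ i ∈ s, ideleOrd (f i) w := by
  classical
  induction s using Finset.induction_on with
  | empty => rw [Finset.prod_empty, Finset.sum_empty, ideleOrd_one]
  | insert a s ha ih => rw [Finset.prod_insert ha, Finset.sum_insert ha, ideleOrd_mul, ih]

/-- `ord_w` as a homomorphism to `Multiplicative ℤ` (auxiliary, for powers). [folklore] -/
def ideleOrdMonoidHom (w : HeightOneSpectrum (𝓞 K)) : ideleGroup K →* Multiplicative ℤ where
  toFun x := Multiplicative.ofAdd (ideleOrd x w)
  map_one' := by rw [ideleOrd_one]; rfl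
  map_mul' x y := by rw [ideleOrd_mul]; rfl

/-- Unfolding `ideleOrdMonoidHom`. [folklore] -/
theorem ideleOrdMonoidHom_apply (w : HeightOneSpectrum (𝓞 K)) (x : ideleGroup K) :
    ideleOrdMonoidHom w x = Multiplicative.ofAdd (ideleOrd x w) := rfl

/-- `ord_w (x ^ n) = n · ord_w x` for `n ∈ ℤ`. [folklore] -/
theorem ideleOrd_zpow (x : ideleGroup K) (n : ℤ) (w : HeightOneSpectrum (𝓞 K)) :
    ideleOrd (x ^ n) w = n * ideleOrd x w := by
  have h := map_zpow (ideleOrdMonoidHom w) x n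
  rw [ideleOrdMonoidHom_apply, ideleOrdMonoidHom_apply, ← ofAdd_zsmul, smul_eq_mul] at h
  exact Multiplicative.ofAdd.injective h

/-- `ord_w (x ^ n) = n · ord_w x` for `n ∈ ℕ`. [folklore] -/
theorem ideleOrd_pow (x : ideleGroup K) (n : ℕ) (w : HeightOneSpectrum (𝓞 K)) :
    ideleOrd (x ^ n) w = n * ideleOrd x w := by
  rw [← zpow_natCast, ideleOrd_zpow]

/-- The local idele of the chosen uniformizer has order `1` at its place. [folklore] -/
theorem ideleOrd_localUnits_uniformizer_self (v : HeightOneSpectrum (𝓞 K)) :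
    ideleOrd (localUnits v (HeckeCharacter.uniformizer K v)) v = 1 := by
  rw [ideleOrd_localUnits_self, HeckeCharacter.valued_uniformizer, WithZero.log_exp, neg_neg]

/-- An idele all of whose orders vanish is a unit idele. [folklore] -/
theorem mem_unitIdeles_of_ideleOrd_eq_zero {x : ideleGroup K} (hx : ∀ v, ideleOrd x v = 0) :
    x ∈ unitIdeles K :=
  fun v => (ideleOrd_eq_zero_iff x v).mp (hx v)

/-! ### The idele of an ideal: `𝔞 ↦ ∏ ⟨ϖ_𝔭⟩^{ν_𝔭(𝔞)}` -/

/-- **The idele of a fractional ideal**: `𝔞 = ∏ 𝔭^{ν_𝔭(𝔞)} ↦ ∏_𝔭 ⟨ϖ_𝔭⟩^{ν_𝔭(𝔞)}`, where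
`⟨ϖ_𝔭⟩` is the idele with the chosen uniformizer `ϖ_𝔭` at `𝔭` and `1` elsewhere — the Artin
homomorphism (`artinHom`) of the datum `𝔭 ↦ ⟨ϖ_𝔭⟩`; a section of the ideal map `x ↦ (x)` of
Cassels–Fröhlich II §17 / Neukirch VI (1.9) ("`I_K^{(𝔪)} → J_K^𝔪`").
[cite: NeukirchANT1999, Ch. VI §1 Prop. (1.9)] -/
def idealIdele : (FractionalIdeal (𝓞 K)⁰ K)ˣ →* ideleGroup K :=
  artinHom fun v : HeightOneSpectrum (𝓞 K) => localUnits v (HeckeCharacter.uniformizer K v)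

/-- Unfolding `idealIdele`. [folklore] -/
theorem idealIdele_apply (𝔞 : (FractionalIdeal (𝓞 K)⁰ K)ˣ) :
    idealIdele 𝔞 = ∏ᶠ v : HeightOneSpectrum (𝓞 K),
      localUnits v (HeckeCharacter.uniformizer K v) ^ FractionalIdeal.count K v (𝔞 : FractionalIdeal (𝓞 K)⁰ K) :=
  rfl

/-- `idealIdele 𝔞` as a finite product over any finite set containing the support of `𝔞`.
[folklore] -/
theorem idealIdele_eq_prod (𝔞 : (FractionalIdeal (𝓞 K)⁰ K)ˣ) (S : Finset (HeightOneSpectrum (𝓞 K)))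
    (hS : ∀ v, FractionalIdeal.count K v (𝔞 : FractionalIdeal (𝓞 K)⁰ K) ≠ 0 → v ∈ S) :
    idealIdele 𝔞 = ∏ v ∈ S,
      localUnits v (HeckeCharacter.uniformizer K v) ^ FractionalIdeal.count K v (𝔞 : FractionalIdeal (𝓞 K)⁰ K) := by
  rw [idealIdele_apply]
  refine finprod_eq_prod_of_mulSupport_subset _ fun v hv => ?_
  rw [Function.mem_mulSupport] at hv
  exact Finset.mem_coe.mpr (hS v fun h0 => hv (by rw [h0, zpow_zero]))

/-- The support of a fractional ideal as a finset. [folklore] -/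
theorem exists_finset_count_ne_zero (𝔞 : (FractionalIdeal (𝓞 K)⁰ K)ˣ) :
    ∃ S : Finset (HeightOneSpectrum (𝓞 K)),
      ∀ v, FractionalIdeal.count K v (𝔞 : FractionalIdeal (𝓞 K)⁰ K) ≠ 0 ↔ v ∈ S :=
  ⟨(FractionalIdeal.finite_factors (𝔞 : FractionalIdeal (𝓞 K)⁰ K)).toFinset, fun v => by
    rw [Set.Finite.mem_toFinset, Set.mem_compl_iff, Set.mem_setOf_eq]⟩

/-- **`ord_𝔭 (idealIdele 𝔞) = ν_𝔭(𝔞)`.** [cite: NeukirchANT1999, Ch. VI §1 Prop. (1.9)] -/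
theorem ideleOrd_idealIdele (𝔞 : (FractionalIdeal (𝓞 K)⁰ K)ˣ) (w : HeightOneSpectrum (𝓞 K)) :
    ideleOrd (idealIdele 𝔞) w = FractionalIdeal.count K w (𝔞 : FractionalIdeal (𝓞 K)⁰ K) := by
  classical
  obtain ⟨S, hS⟩ := exists_finset_count_ne_zero 𝔞
  rw [idealIdele_eq_prod 𝔞 S fun v hv => (hS v).mp hv, ideleOrd_prod]
  simp_rw [ideleOrd_zpow]
  have hterm : ∀ v ∈ S, FractionalIdeal.count K v (𝔞 : FractionalIdeal (𝓞 K)⁰ K) *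
      ideleOrd (localUnits v (HeckeCharacter.uniformizer K v)) w =
        if v = w then FractionalIdeal.count K w (𝔞 : FractionalIdeal (𝓞 K)⁰ K) else 0 := by
    intro v _
    split_ifs with h
    · subst h; rw [ideleOrd_localUnits_uniformizer_self, mul_one]
    · rw [ideleOrd_localUnits_of_ne _ (Ne.symm h), mul_zero]
  rw [Finset.sum_congr rfl hterm, Finset.sum_ite_eq']
  split_ifs with hw
  · rfl
  · exact (not_not.mp fun h => hw ((hS w).mp h)).symm

/-- `idealIdele 𝔞 ∈ W_𝔪` for `𝔞` prime to `𝔪` (its components at the primes of `𝔪` and at infinity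
are `1`). [folklore] -/
theorem idealIdele_mem_congruenceIdeles {𝔪 : Ideal (𝓞 K)} (h𝔪 : 𝔪 ≠ ⊥)
    {𝔞 : (FractionalIdeal (𝓞 K)⁰ K)ˣ} (h𝔞 : 𝔞 ∈ idealsPrimeTo 𝔪) :
    idealIdele 𝔞 ∈ congruenceIdeles 𝔪 := by
  classical
  obtain ⟨S, hS⟩ := exists_finset_count_ne_zero 𝔞
  rw [idealIdele_eq_prod 𝔞 S fun v hv => (hS v).mp hv]
  refine Subgroup.prod_mem _ fun v _ => ?_
  by_cases hv : 𝔪 ≤ v.asIdeal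
  · rw [h𝔞 v hv, zpow_zero]; exact one_mem _
  · exact Subgroup.zpow_mem _ (localUnits_mem_congruenceIdeles h𝔪 hv _) _

/-! ### The ideal of an idele: `x ↦ (x) = ∏ 𝔭^{ord_𝔭 x}` -/

/-- **The ideal `(x) = ∏_𝔭 𝔭^{ord_𝔭 x}` of an idele** (Cassels–Fröhlich II §17; the tree's
`FiniteAdeleRing.toFractionalIdeal` of the finite part), as an invertible fractional ideal.
[cite: CasselsFrohlichANT1967, Ch. II §17] -/
def ideleIdeal (x : ideleGroup K) : (FractionalIdeal (𝓞 K)⁰ K)ˣ :=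
  Units.mk0 (Automorphic.FiniteAdeleRing.toFractionalIdeal (𝓞 K) K (ideleGroup.finPart K x))
    (Automorphic.FiniteAdeleRing.toFractionalIdeal_ne_zero _)

/-- **`ν_𝔭((x)) = ord_𝔭 x`.** [cite: CasselsFrohlichANT1967, Ch. II §17] -/
theorem count_ideleIdeal (x : ideleGroup K) (w : HeightOneSpectrum (𝓞 K)) :
    FractionalIdeal.count K w (ideleIdeal x : FractionalIdeal (𝓞 K)⁰ K) = ideleOrd x w := by
  rw [ideleIdeal, Units.val_mk0, Automorphic.FiniteAdeleRing.count_toFractionalIdeal]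
  rfl

/-- An idele in `W_𝔪` is a unit at the primes of `𝔪`. [folklore] -/
theorem ideleOrd_eq_zero_of_mem_congruenceIdeles {𝔪 : Ideal (𝓞 K)} (h𝔪 : 𝔪 ≠ ⊥) {y : ideleGroup K}
    (hy : y ∈ congruenceIdeles 𝔪) {v : HeightOneSpectrum (𝓞 K)} (hv : 𝔪 ≤ v.asIdeal) :
    ideleOrd y v = 0 := by
  have hn : modulusExp 𝔪 v ≠ 0 := (modulusExp_ne_zero_iff 𝔪 h𝔪 v).mpr hv
  have hlt : Valued.v ((y : AdeleRing (𝓞 K) K).2 v - 1) < 1 := by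
    refine (hy.1 v hn).trans_lt ?_
    rw [← WithZero.exp_zero, WithZero.exp_lt_exp, neg_lt_zero, Int.natCast_pos]
    exact Nat.pos_of_ne_zero hn
  rw [ideleOrd_eq_zero_iff]
  have := Valuation.map_eq_of_sub_lt Valued.v (x := (1 : v.adicCompletion K))
    (y := (y : AdeleRing (𝓞 K) K).2 v) (by rw [map_one]; exact hlt)
  rwa [map_one] at this

/-- The ideal of an idele in `W_𝔪` is prime to `𝔪`. [folklore] -/
theorem ideleIdeal_mem_idealsPrimeTo {𝔪 : Ideal (𝓞 K)} (h𝔪 : 𝔪 ≠ ⊥) {y : ideleGroup K}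
    (hy : y ∈ congruenceIdeles 𝔪) : ideleIdeal y ∈ idealsPrimeTo 𝔪 := fun v hv => by
  rw [count_ideleIdeal]; exact ideleOrd_eq_zero_of_mem_congruenceIdeles h𝔪 hy hv

/-- **`y ≡ idealIdele (y)` modulo `W_𝔪 ∩ 𝕌_K`** for `y ∈ W_𝔪`: the quotient
`y · (idealIdele (y))⁻¹` has all orders `0` and lies in `W_𝔪`. [cite: NeukirchANT1999, Ch. VI §1 Prop. (1.9) (proof)] -/
theorem mul_idealIdele_ideleIdeal_inv_mem {𝔪 : Ideal (𝓞 K)} (h𝔪 : 𝔪 ≠ ⊥) {y : ideleGroup K}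
    (hy : y ∈ congruenceIdeles 𝔪) :
    y * (idealIdele (ideleIdeal y))⁻¹ ∈ congruenceIdeles 𝔪 ⊓ unitIdeles K := by
  refine Subgroup.mem_inf.mpr ⟨(congruenceIdeles 𝔪).mul_mem hy ((congruenceIdeles 𝔪).inv_mem
    (idealIdele_mem_congruenceIdeles h𝔪 (ideleIdeal_mem_idealsPrimeTo h𝔪 hy))),
    mem_unitIdeles_of_ideleOrd_eq_zero fun v => ?_⟩
  rw [ideleOrd_mul, ideleOrd_inv, ideleOrd_idealIdele, count_ideleIdeal, add_neg_cancel]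

/-! ### The comparison homomorphism `ℐ_K → J_K / Kˣ N_{L/K} J_L` -/

section Comparison

variable (L : Type v) [Field L] [NumberField L] [Algebra K L] [FiniteDimensional K L]

/-- The comparison homomorphism `𝔞 ↦ idealIdele 𝔞 mod Kˣ N_{L/K} J_L`. [folklore] -/
def idealIdeleQuot : (FractionalIdeal (𝓞 K)⁰ K)ˣ →* ideleGroup K ⧸ normGroup K L :=
  (QuotientGroup.mk' (normGroup K L)).comp idealIdele

/-- Unfolding `idealIdeleQuot`. [folklore] -/
theorem idealIdeleQuot_apply (𝔞 : (FractionalIdeal (𝓞 K)⁰ K)ˣ) :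
    idealIdeleQuot L 𝔞 = (idealIdele 𝔞 : ideleGroup K ⧸ normGroup K L) := rfl

variable {L}

/-- **`ℐ_K(𝔪) → J_K / Kˣ N_{L/K} J_L` is onto** when `𝔪` is admissible (`W_𝔪 ∩ 𝕌_K ≤ Kˣ N J_L`):
write `x = a⁻¹ y` with `a ∈ Kˣ`, `y ∈ W_𝔪` (`𝕀_K = Kˣ W_𝔪`, weak approximation) and
`y ≡ idealIdele (y)`. [cite: Childress2009, Ch. 4 §2 (PDF pp. 75–80)] -/
theorem exists_mem_idealsPrimeTo_mk_idealIdele_eq {𝔪 : Ideal (𝓞 K)} (h𝔪 : 𝔪 ≠ ⊥)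
    (hW : congruenceIdeles 𝔪 ⊓ unitIdeles K ≤ normGroup K L) (x : ideleGroup K) :
    ∃ 𝔞 ∈ idealsPrimeTo 𝔪, idealIdeleQuot L 𝔞 = (x : ideleGroup K ⧸ normGroup K L) := by
  obtain ⟨a, ha⟩ := exists_principalIdele_mul_mem_congruenceIdeles h𝔪 x
  set y : ideleGroup K := principalIdele K a * x with hydef
  refine ⟨ideleIdeal y, ideleIdeal_mem_idealsPrimeTo h𝔪 ha, ?_⟩
  rw [idealIdeleQuot_apply, QuotientGroup.eq]
  -- `(idealIdele (y))⁻¹ x = ((y (idealIdele (y))⁻¹) · (a)⁻¹)`, up to commutativity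
  have hz := hW (mul_idealIdele_ideleIdeal_inv_mem h𝔪 ha)
  have hpr : (principalIdele K a)⁻¹ ∈ normGroup K L :=
    inv_mem (principalIdeles_le_normGroup K L (principalIdele_mem a))
  have : (idealIdele (ideleIdeal y))⁻¹ * x = (y * (idealIdele (ideleIdeal y))⁻¹) * (principalIdele K a)⁻¹ := by
    rw [hydef]; simp only [mul_comm, mul_left_comm, mul_assoc, mul_inv_cancel_left]
  rw [this]
  exact mul_mem hz hpr

/-- The comparison map restricted to `ℐ_K(𝔪)` is onto (subgroup form). [folklore] -/
theorem map_idealIdeleQuot_idealsPrimeTo_eq_top {𝔪 : Ideal (𝓞 K)} (h𝔪 : 𝔪 ≠ ⊥)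
    (hW : congruenceIdeles 𝔪 ⊓ unitIdeles K ≤ normGroup K L) :
    (idealsPrimeTo 𝔪).map (idealIdeleQuot L) = ⊤ := by
  rw [eq_top_iff]
  intro q _
  obtain ⟨x, rfl⟩ := QuotientGroup.mk_surjective q
  obtain ⟨𝔞, h𝔞, h⟩ := exists_mem_idealsPrimeTo_mk_idealIdele_eq h𝔪 hW x
  exact ⟨𝔞, h𝔞, h⟩

/-- A ray element gives a principal idele in `W_𝔪` (`rayElements 𝔪 = Kˣ ∩ W_𝔪`, easy inclusion).
[cite: NeukirchANT1999, Ch. VI §1 Prop. (1.9)] -/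
theorem principalIdele_mem_congruenceIdeles_of_mem_rayElements {𝔪 : Ideal (𝓞 K)} {a : Kˣ}
    (ha : a ∈ rayElements 𝔪) : principalIdele K a ∈ congruenceIdeles 𝔪 := by
  refine ⟨fun v hv => ?_, fun w hw => ?_⟩
  · rw [principalIdele_snd, ← map_one (algebraMap K (v.adicCompletion K)), ← map_sub,
      valued_algebraMap_adicCompletion]
    exact ha.1 v hv
  · rw [principalIdele_fst, InfiniteAdeleRing.algebraMap_apply]
    have e : InfinitePlace.Completion.extensionEmbeddingOfIsReal hw ((a : K) : w.Completion) =
        InfinitePlace.embedding_of_isReal hw (a : K) :=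
      InfinitePlace.Completion.extensionEmbeddingOfIsReal_coe hw (WithAbs.toAbs w.1 (a : K))
    rw [e]
    exact ha.2 _

/-- **The ray dies in `J_K / Kˣ N_{L/K} J_L`** for an admissible modulus: for a ray element `a`,
`idealIdele (a) ≡ (a)` modulo `W_𝔪 ∩ 𝕌_K ≤ Kˣ N J_L`, and `(a)` is principal.
[cite: Childress2009, Ch. 4 §2 (PDF pp. 75–80)] -/
theorem ray_le_ker_idealIdeleQuot {𝔪 : Ideal (𝓞 K)} (h𝔪 : 𝔪 ≠ ⊥)
    (hW : congruenceIdeles 𝔪 ⊓ unitIdeles K ≤ normGroup K L) :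
    ray 𝔪 ≤ (idealIdeleQuot L).ker := by
  rintro I ⟨a, ha, rfl⟩
  rw [MonoidHom.mem_ker, idealIdeleQuot_apply, QuotientGroup.eq_one_iff]
  set I := toPrincipalIdeal (𝓞 K) K a with hI
  have hIJ : I ∈ idealsPrimeTo 𝔪 := ray_le_idealsPrimeTo h𝔪 ⟨a, ha, rfl⟩
  -- `z = (a) · (idealIdele I)⁻¹ ∈ W_𝔪 ∩ 𝕌_K`
  have hz : principalIdele K a * (idealIdele I)⁻¹ ∈ congruenceIdeles 𝔪 ⊓ unitIdeles K := by
    refine Subgroup.mem_inf.mpr ⟨(congruenceIdeles 𝔪).mul_mem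
      (principalIdele_mem_congruenceIdeles_of_mem_rayElements ha)
      ((congruenceIdeles 𝔪).inv_mem (idealIdele_mem_congruenceIdeles h𝔪 hIJ)),
      mem_unitIdeles_of_ideleOrd_eq_zero fun v => ?_⟩
    rw [ideleOrd_mul, ideleOrd_inv, ideleOrd_idealIdele, ideleOrd_principalIdele, hI,
      count_toPrincipalIdeal, add_neg_cancel]
  have h1 : idealIdele I = (principalIdele K a * (idealIdele I)⁻¹)⁻¹ * principalIdele K a := by
    rw [mul_inv_rev, inv_inv, inv_mul_cancel_right]
  rw [h1]
  exact mul_mem (inv_mem (hW hz)) (principalIdeles_le_normGroup K L (principalIdele_mem a))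

/-- **`𝒩_{L/K}(𝔪)` dies in `J_K / Kˣ N_{L/K} J_L`**, granted that `⟨ϖ_𝔮⟩^{f(𝔔|𝔮)}` is in the norm
group for the primes `𝔔 ∣ 𝔮 ∤ 𝔪` (on a generator `𝔮^{f}`, `idealIdele (𝔮^f) = ⟨ϖ_𝔮⟩^f`).
[cite: Childress2009, Ch. 4 §2 (PDF pp. 75–80)] -/
theorem normSubgroup_le_ker_idealIdeleQuot {𝔪 : Ideal (𝓞 K)}
    (hFrob : ∀ 𝔮 : HeightOneSpectrum (𝓞 K), ¬ 𝔪 ≤ 𝔮.asIdeal → ∀ Q ∈ 𝔮.asIdeal.primesOver (𝓞 L),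
      localUnits 𝔮 (HeckeCharacter.uniformizer K 𝔮) ^ Q.inertiaDeg (𝓞 K) ∈ normGroup K L) :
    normSubgroup 𝔪 L ≤ (idealIdeleQuot L).ker := by
  rw [normSubgroup, Subgroup.closure_le]
  rintro u ⟨𝔮, h𝔮, Q, hQ, rfl⟩
  rw [SetLike.mem_coe, MonoidHom.mem_ker, idealIdeleQuot_apply, QuotientGroup.eq_one_iff, idealIdele,
    artinHom_primePowUnit]
  exact hFrob 𝔮 h𝔮 Q hQ

/-- **The dictionary `[J_K : Kˣ N_{L/K} J_L] ∣ [ℐ_K(𝔪) : 𝒫⁺_{K,𝔪} 𝒩_{L/K}(𝔪)]`.**  For a finite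
extension `L/K` of number fields and a modulus `𝔪 ≠ 0` which is admissible (`hW`:
`W_𝔪 ∩ 𝕌_K ≤ Kˣ N J_L`) and off which the prime powers `𝔮^{f(𝔔|𝔮)}` are norms (`hFrob`), the
comparison map `ℐ_K(𝔪) → J_K/Kˣ N J_L` is onto and kills `𝒫⁺_{K,𝔪} 𝒩_{L/K}(𝔪)`, so the idelic
norm index divides the ideal-theoretic one (Childress Ch. 4 §2 with §5: "`J_F/F^× N_{K/F} J_K`
[…] `ℐ_F(𝔪)/𝒫⁺_{F,𝔪} 𝒩_{K/F}(𝔪)`"). [cite: Childress2009, Ch. 4 §5 Thm. 5.12 (PDF p. 103)] -/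
theorem index_normGroup_dvd_relIndex_ray_sup_normSubgroup {𝔪 : Ideal (𝓞 K)} (h𝔪 : 𝔪 ≠ ⊥)
    (hW : congruenceIdeles 𝔪 ⊓ unitIdeles K ≤ normGroup K L)
    (hFrob : ∀ 𝔮 : HeightOneSpectrum (𝓞 K), ¬ 𝔪 ≤ 𝔮.asIdeal → ∀ Q ∈ 𝔮.asIdeal.primesOver (𝓞 L),
      localUnits 𝔮 (HeckeCharacter.uniformizer K 𝔮) ^ Q.inertiaDeg (𝓞 K) ∈ normGroup K L) :
    (normGroup K L).index ∣ (ray 𝔪 ⊔ normSubgroup 𝔪 L).relIndex (idealsPrimeTo 𝔪) := by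
  set J : Subgroup (FractionalIdeal (𝓞 K)⁰ K)ˣ := idealsPrimeTo 𝔪 with hJ
  set H : Subgroup (FractionalIdeal (𝓞 K)⁰ K)ˣ := ray 𝔪 ⊔ normSubgroup 𝔪 L with hH
  set Ψ : J →* ideleGroup K ⧸ normGroup K L := (idealIdeleQuot L).comp J.subtype with hΨ
  -- `Ψ` is onto, so `[J_K : Kˣ N J_L] = #(J_K/Kˣ N J_L) = [J : ker Ψ]`
  have hsurj : Function.Surjective Ψ := by
    intro q
    obtain ⟨x, rfl⟩ := QuotientGroup.mk_surjective q
    obtain ⟨𝔞, h𝔞, h⟩ := exists_mem_idealsPrimeTo_mk_idealIdele_eq h𝔪 hW x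
    exact ⟨⟨𝔞, h𝔞⟩, h⟩
  have hidx : (normGroup K L).index = Ψ.ker.index := by
    rw [Subgroup.index_ker, MonoidHom.range_eq_top.mpr hsurj, Subgroup.card_top]; rfl
  -- `H ∩ J ≤ ker Ψ`
  have hle : H.subgroupOf J ≤ Ψ.ker := by
    intro 𝔞 h𝔞
    rw [Subgroup.mem_subgroupOf] at h𝔞
    rw [MonoidHom.mem_ker, hΨ, MonoidHom.comp_apply, Subgroup.coe_subtype, ← MonoidHom.mem_ker]
    exact (sup_le (ray_le_ker_idealIdeleQuot h𝔪 hW) (normSubgroup_le_ker_idealIdeleQuot hFrob)) h𝔞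
  rw [hidx]
  exact Subgroup.index_dvd_of_le hle

/-- **The Global Cyclic Norm Index Inequality in ideal-theoretic form, from the idelic one.**
If `[L : K]` divides the (finite) idelic norm index `[J_K : Kˣ N_{L/K} J_L]` — the tree's
`IdeleHerbrand.card_dvd_index_normGroup` for `L/K` cyclic — then for every admissible modulus
`𝔪 ≠ 0` as above, `[L : K] ≤ [ℐ_K(𝔪) : 𝒫⁺_{K,𝔪} 𝒩_{L/K}(𝔪)]` (Childress Thm. 5.12 as printed:
"`a = [ℐ_F(𝔪) : 𝒫⁺_{F,𝔪} 𝒩_{K/F}(𝔪)] ≥ n = [K : F]`"). [cite: Childress2009, Ch. 4 §5 Thm. 5.12 (PDF p. 103)] -/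
theorem finrank_le_relIndex_ray_sup_normSubgroup_of_dvd_index {𝔪 : Ideal (𝓞 K)} (h𝔪 : 𝔪 ≠ ⊥)
    (hW : congruenceIdeles 𝔪 ⊓ unitIdeles K ≤ normGroup K L)
    (hFrob : ∀ 𝔮 : HeightOneSpectrum (𝓞 K), ¬ 𝔪 ≤ 𝔮.asIdeal → ∀ Q ∈ 𝔮.asIdeal.primesOver (𝓞 L),
      localUnits 𝔮 (HeckeCharacter.uniformizer K 𝔮) ^ Q.inertiaDeg (𝓞 K) ∈ normGroup K L)
    (hdvd : Module.finrank K L ∣ (normGroup K L).index) :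
    Module.finrank K L ≤ (ray 𝔪 ⊔ normSubgroup 𝔪 L).relIndex (idealsPrimeTo 𝔪) := by
  haveI : Finite (RayClassGroup 𝔪) := finite_rayClassGroup h𝔪
  have hray0 : (ray 𝔪).relIndex (idealsPrimeTo 𝔪) ≠ 0 := Subgroup.index_ne_zero_of_finite
  have hH0 : (ray 𝔪 ⊔ normSubgroup 𝔪 L).relIndex (idealsPrimeTo 𝔪) ≠ 0 := fun h0 =>
    hray0 (Subgroup.relIndex_eq_zero_of_le_left (le_sup_left : ray 𝔪 ≤ ray 𝔪 ⊔ normSubgroup 𝔪 L) h0)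
  exact Nat.le_of_dvd (Nat.pos_of_ne_zero hH0)
    (hdvd.trans (index_normGroup_dvd_relIndex_ray_sup_normSubgroup h𝔪 hW hFrob))

end Comparison

end Literature.NumberTheory.GaloisRepresentations
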